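import Summits.BirchSwinnertonDyer.Rank1Residual.AdditivePotMult.GreenbergVatsalTransferMatching
import Summits.BirchSwinnertonDyer.Rank1Residual.Additive.TorsionOrderOfTorsionIso
import HarnessLib

/-!
# The Greenberg–Vatsal transfer COUNT "the order of `S^{Σ₀}_{E_i[p]}(ℚ_∞)` is independent of `i`"
# at EVERY ODD prime `p` on EVERY congruent pair of the four additive potentially-ordinary loci
# ((G-ord, `e = 2`)², (M)², mixed), every local hypothesis discharged ((M) side mod A40/A41)
# (cell `b2b-bsdres`, team n1011, seat p12 (gen 5); row T-E3g-GV29o FILE 2; ROUTE-2 II.15.4 ARM α,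
# kernel half — the general-`p`, all-loci successor of GEN 4's `GreenbergVatsalTransferCountThree`)

HONEST FRAMING (cell `b2b-bsdres`, run/shared/lean/b2b/bsd-rank1-residual/, verbatim in every
file): the goal of the cell is to DELETE the COMBINATION-SHAPED residual classes of the
Birch–Swinnerton-Dyer formula for ALL analytic-rank `≤ 1` elliptic curves over `ℚ` — "full BSD
formula for every rank `≤ 1` curve in class `C`" assembled STRICTLY from published theorems — so
that the rank-`≤ 1` remainder becomes exactly the CONSTRUCTION-SHAPED classes, which are TYPED
(missing-input `Prop`s), NOT attempted. This is not "finishing BSD". Team n1011: research routes on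
CONSTRUCTION-SHAPED classes; prove what is provable now; no claim beyond stated classes; census
output = EVIDENCE, never a Literature fact; RESIDUAL-MAP marks UNCHANGED; nothing is booked by this
file. THEOREMS ONLY: no definition, no named fact; p07's `RamifiedOrdinaryLineMatching[Mixed]`,
cc-typer-2's `RamifiedOrdinaryLineUnique*` and eisenstein-p2's `X2.GreenbergVatsalTransferCurve` are
consumed BY NAME and untouched.

## What

Greenberg–Vatsal p. 27: "by proposition (2.8), `Sel^{Σ₀}_{E_i}(ℚ_∞)[p] = S^{Σ₀}_{A_i}(ℚ_∞)[p] ≅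
S^{Σ₀}_{A_i[p]}(ℚ_∞)`. Furthermore, the order of this group is independent of `i` since `A₁[p] ≅ A₂[p]`
as `G_ℚ`-modules." For `E₁, E₂/ℚ` globally minimal, `p` odd, each `E_i` additive at `p` of potentially
good ORDINARY reduction with semistability defect `e = 2` or potentially MULTIPLICATIVE reduction
(the four loci X4♯(G-ord, `e = 2`), X3♯(G-ord, `e = 2`), X4(M), X3♯(M) — every combination), good
outside `S₀ ∪ {p}`, `p ∤ #E₁(ℚ)_tors` (automatic on X4; the partner's bit follows from the congruence,
cc-typer-2's `not_dvd_torsionOrder_of_torsionIso`), and `E₁[p] ≅ E₂[p]` (route G's `TorsionIso`):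
for ANY `ℤ_p`-extension `κ` of `ℚ` there are ramified ordinary data `L_i` above `p` with
**`#(S^{S₀}_{E₁[p^∞]}(ℚ_∞) ⊓ H¹[p]) = #(S^{S₀}_{E₂[p^∞]}(ℚ_∞) ⊓ H¹[p])`**, the (M) side modulo the
PUBLISHED Tate uniformisation A40/A41 exactly as everywhere on the (M) rows.

* §1 the `ℚ`-assembly `Additive.exists_data_natCard_gvSelmerInfty_inf_torsion_eq_of_forall_lines`:
  per-place ramified ordinary lines with the Remark-(2.9) clause that MATCH under every congruence
  (FILE 1) + `TorsionIso` + `p ∤ #E₁(ℚ)_tors` ⟹ the count (FILE 1 §1 +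
  GEN 4's `finite_fixedPoints_of_not_dvd_torsionOrder` / `natCard_torsionBy_fixedPoints_eq_one`).
* §2 (G-ord, `e = 2`)²: `ClassX4Gord/ClassX3Gord.exists_data_natCard_gvSelmerInfty_inf_torsion_eq`
  (UNCONDITIONAL; every odd `p`, `p = 3` included — where it re-proves GEN 4's `…_eq_three`, and §3–§4
  re-prove cc-typer-1's `GreenbergVatsalTransferCountThreePotMult`, by a different intrinsic input).
* §3 (M)²: `PotMult/ClassX4M/ClassX3M.exists_data_natCard_gvSelmerInfty_inf_torsion_eq` (mod A40/A41).
* §4 mixed: `exists_data_natCard_gvSelmerInfty_inf_torsion_eq_of_typeGOrd_potMult`,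
  `ClassX4M.…_of_classX4Gord`, `ClassX3M.…_of_classX3Gord` (mod A40/A41 on the (M) side).

What this does NOT give: the LINK `Sel_{p^∞}(E_i/ℚ_∞) = S(ℚ_∞)` (T-RD, closed on the four cells by
p05/p07/cc-typer-2) and the `λ`-reading (Props. (2.5)/(2.8) second half, Cor. (2.3): the typed GV
record) — hence no `λ`-statement, no class theorem, nothing booked; X3♯/X4♯ stay as labelled. It is
the kernel half of what the GV composed RECORD asserts on these pairs; the record consumers
(T-RD-M (iv)/(v), T-RD-GG) are complementary and untouched.

References: [GreenbergVatsal2000] §2 Prop. (2.8), Remark (2.9), pp. 26–27 (held text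
`paper:arxiv-math_9906215`); [EmertonPollackWeston2006] pp. 2–3, §3.1 (eq:ordes); [SilvermanATAEC1994]
V.5.3/5.4; ROUTE-2 II.15.4.
-/

set_option autoImplicit false

noncomputable section

open scoped Classical NumberField AddSubgroup

open NumberField IsDedekindDomain Field WeierstrassCurve
  Literature.NumberTheory.GaloisRepresentations Literature.NumberTheory.EllipticCurves
  Literature.NumberTheory.EllipticCurves.GreenbergSelmer
  Literature.NumberTheory.EllipticCurves.EmertonPollackWeston2006
  Literature.NumberTheory.EllipticCurves.Rank1Residual
  Summit.BirchSwinnertonDyer.Rank1Residual.X2.TorsionComparison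
  Summit.BirchSwinnertonDyer.Rank1Residual.X2.GreenbergVatsalTorsion


/-! ## §1. The `ℚ`-assembly -/

namespace Summit.BirchSwinnertonDyer.Rank1Residual.Additive

open Summit.BirchSwinnertonDyer.Rank1Residual.X1.CongruenceTransfer (TorsionIso)

section Assembly

variable {p : ℕ} [hp : Fact p.Prime] {W₁ W₂ : WeierstrassCurve ℚ} [W₁.IsElliptic] [W₂.IsElliptic]
  (κ : ZpExtension ℚ p) (S₀ : Set (HeightOneSpectrum (𝓞 ℚ)))

/-- **The `ℚ`-assembly of GV's transfer count.** `E₁, E₂/ℚ`; at every `v ∋ p` ramified ordinary lines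
`C_{1,v}`, `C_{2,v}` with `(E_i[p^∞]/C_{i,v})^{ker κ ⊓ I_v} = 0` that MATCH under every
`Γ_ℚ`-equivariant `E₁[p] ≃+ E₂[p]`; `p ∤ #E₁(ℚ)_tors` (hence `p ∤ #E₂(ℚ)_tors`, cc-typer-2's
`not_dvd_torsionOrder_of_torsionIso`; so `E_i(ℚ_∞)[p] = 0`); `E_i` good outside `S₀ ∪ {p}`;
`E₁[p] ≅ E₂[p]` (`TorsionIso`). Then, for ANY `ℤ_p`-extension `κ` of `ℚ`, there are data of
ramified ordinary lines `L₁`, `L₂` with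
`#(S^{S₀}_{E₁[p^∞]}(ℚ_∞) ⊓ H¹[p]) = #(S^{S₀}_{E₂[p^∞]}(ℚ_∞) ⊓ H¹[p])` — GV p. 27, verbatim shape.
[cite: GreenbergVatsal2000, §2 Prop. (2.8), Remark (2.9) and pp. 26–27] -/
theorem exists_data_natCard_gvSelmerInfty_inf_torsion_eq_of_forall_lines
    (hlines : ∀ (v : HeightOneSpectrum (𝓞 ℚ)) (hv : ((p : ℕ) : 𝓞 ℚ) ∈ v.asIdeal),
      ∃ (L₁ : LocalDatum ℚ (W₁.geomPrimaryTorsion p) v) (L₂ : LocalDatum ℚ (W₂.geomPrimaryTorsion p) v),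
        IsRamifiedOrdinaryLine W₁ p L₁ ∧ IsRamifiedOrdinaryLine W₂ p L₂ ∧
        (∀ a ∈ invariants (inertiaIn κ.kerSubgroup v) L₁.Gr, a = 0) ∧
        (∀ a ∈ invariants (inertiaIn κ.kerSubgroup v) L₂.Gr, a = 0) ∧
        ∀ e : geomTorsion W₁ (p : ℤ) ≃+ geomTorsion W₂ (p : ℤ),
          (∀ (σ : absoluteGaloisGroup ℚ) (P : geomTorsion W₁ (p : ℤ)), e (σ • P) = σ • e P) →
          ∀ P : geomTorsion W₁ (p : ℤ),
            AddSubgroup.inclusion (geomTorsion_le_geomPrimaryTorsion W₁ p) P ∈ L₁.plus ↔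
              AddSubgroup.inclusion (geomTorsion_le_geomPrimaryTorsion W₂ p) (e P) ∈ L₂.plus)
    (htors₁ : ¬ p ∣ W₁.torsionOrder)
    (hS₁ : ∀ v : HeightOneSpectrum (𝓞 ℚ), v ∉ S₀ → ((p : ℕ) : 𝓞 ℚ) ∉ v.asIdeal →
      W₁.HasGoodReductionAt v)
    (hS₂ : ∀ v : HeightOneSpectrum (𝓞 ℚ), v ∉ S₀ → ((p : ℕ) : 𝓞 ℚ) ∉ v.asIdeal →
      W₂.HasGoodReductionAt v)
    (hT : TorsionIso W₁ W₂ p) :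
    ∃ (L₁ : Data ℚ (W₁.geomPrimaryTorsion p) p) (L₂ : Data ℚ (W₂.geomPrimaryTorsion p) p),
      (∀ v hv, IsRamifiedOrdinaryLine W₁ p (L₁ v hv)) ∧ (∀ v hv, IsRamifiedOrdinaryLine W₂ p (L₂ v hv)) ∧
      Nat.card (gvSelmerInfty κ (W₁.geomPrimaryTorsion p) L₁ S₀ ⊓
          (subgroupH1 κ.kerSubgroup (W₁.geomPrimaryTorsion p))[(p : ℤ)] :
          AddSubgroup (subgroupH1 κ.kerSubgroup (W₁.geomPrimaryTorsion p))) =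
        Nat.card (gvSelmerInfty κ (W₂.geomPrimaryTorsion p) L₂ S₀ ⊓
          (subgroupH1 κ.kerSubgroup (W₂.geomPrimaryTorsion p))[(p : ℤ)] :
          AddSubgroup (subgroupH1 κ.kerSubgroup (W₂.geomPrimaryTorsion p))) := by
  choose L₁ L₂ hL using hlines
  have htors₂ : ¬ p ∣ W₂.torsionOrder := not_dvd_torsionOrder_of_torsionIso hT htors₁
  obtain ⟨θ, hθ⟩ := X2.GreenbergVatsalTransferCurve.exists_equiv_of_torsionIso hT
  haveI := finite_fixedPoints_of_not_dvd_torsionOrder W₁ κ htors₁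
  haveI := finite_fixedPoints_of_not_dvd_torsionOrder W₂ κ htors₂
  have h := GreenbergVatsalTransferRamified.natCard_gvSelmer_inf_torsion_mul_eq_curve_of_map_plus_eq p
    κ.kerSubgroup W₁ W₂ L₁ L₂ S₀ hS₁ hS₂
    (fun v hv ↦ fun _ hm ↦ (hL v hv).1.divisible hm)
    (fun v hv ↦ fun _ hm ↦ (hL v hv).2.1.divisible hm)
    (fun v hv ↦ (hL v hv).2.2.1) (fun v hv ↦ (hL v hv).2.2.2.1) θ hθ
    (fun v hv ↦ map_torsionDatum_plus_eq_of_forall_matching (L₁ v hv) (L₂ v hv)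
      (hL v hv).2.2.2.2 θ hθ)
  rw [natCard_torsionBy_fixedPoints_eq_one W₁ κ htors₁, natCard_torsionBy_fixedPoints_eq_one W₂ κ htors₂,
    mul_one, mul_one] at h
  exact ⟨L₁, L₂, fun v hv ↦ (hL v hv).1, fun v hv ↦ (hL v hv).2.1, h⟩

end Assembly
/-! ## §2. (G-ord, `e = 2`)² — unconditional -/

section Gord

variable {p : ℕ} [hp : Fact p.Prime] {W₁ W₂ : WeierstrassCurve ℚ} [W₁.IsElliptic]
  [W₁.IsGloballyMinimal] [W₂.IsElliptic] [W₂.IsGloballyMinimal] (κ : ZpExtension ℚ p)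
  (S₀ : Set (HeightOneSpectrum (𝓞 ℚ)))

/-- **GV's transfer count at EVERY odd additive prime `p`, X4♯(G-ord, `e = 2`) pairs, every local
hypothesis discharged.** `E₁, E₂ ∈` X4♯(G-ord) at `p` with `semistabilityIndex E_i p = 2` (automatic at
`p = 3`), good outside `S₀ ∪ {p}`, `E₁[p] ≅ E₂[p]` (`TorsionIso`), `κ` ANY `ℤ_p`-extension of `ℚ`:
there are ramified ordinary data `L₁, L₂` above `p` with
`#(S^{S₀}_{E₁[p^∞]}(ℚ_∞) ⊓ H¹[p]) = #(S^{S₀}_{E₂[p^∞]}(ℚ_∞) ⊓ H¹[p])`. The general-`p` successor of GEN 4's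
`…_eq_three` (which read the I-fixed line at `3`). X4♯ stays CONSTRUCTION-SHAPED; nothing booked.
[cite: GreenbergVatsal2000, §2 Prop. (2.8), Remark (2.9) and pp. 26–27] -/
theorem ClassX4Gord.exists_data_natCard_gvSelmerInfty_inf_torsion_eq
    (hX₁ : ClassX4Gord W₁ p) (he₁ : semistabilityIndex W₁ p = 2)
    (hX₂ : ClassX4Gord W₂ p) (he₂ : semistabilityIndex W₂ p = 2)
    (hS₁ : ∀ v : HeightOneSpectrum (𝓞 ℚ), v ∉ S₀ → ((p : ℕ) : 𝓞 ℚ) ∉ v.asIdeal →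
      W₁.HasGoodReductionAt v)
    (hS₂ : ∀ v : HeightOneSpectrum (𝓞 ℚ), v ∉ S₀ → ((p : ℕ) : 𝓞 ℚ) ∉ v.asIdeal →
      W₂.HasGoodReductionAt v)
    (hT : TorsionIso W₁ W₂ p) :
    ∃ (L₁ : Data ℚ (W₁.geomPrimaryTorsion p) p) (L₂ : Data ℚ (W₂.geomPrimaryTorsion p) p),
      (∀ v hv, IsRamifiedOrdinaryLine W₁ p (L₁ v hv)) ∧ (∀ v hv, IsRamifiedOrdinaryLine W₂ p (L₂ v hv)) ∧
      Nat.card (gvSelmerInfty κ (W₁.geomPrimaryTorsion p) L₁ S₀ ⊓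
          (subgroupH1 κ.kerSubgroup (W₁.geomPrimaryTorsion p))[(p : ℤ)] :
          AddSubgroup (subgroupH1 κ.kerSubgroup (W₁.geomPrimaryTorsion p))) =
        Nat.card (gvSelmerInfty κ (W₂.geomPrimaryTorsion p) L₂ S₀ ⊓
          (subgroupH1 κ.kerSubgroup (W₂.geomPrimaryTorsion p))[(p : ℤ)] :
          AddSubgroup (subgroupH1 κ.kerSubgroup (W₂.geomPrimaryTorsion p))) :=
  exists_data_natCard_gvSelmerInfty_inf_torsion_eq_of_forall_lines κ S₀
    (fun v hv ↦ by
      obtain ⟨L₁, L₂, hL₁, hL₂, hm⟩ :=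
        AdditivePotMult.GreenbergVatsalTransferCountOdd.exists_lines_matching_of_typeGOrd_typeGOrd
          hX₁.addv.1 hX₁.typeGOrd hX₁.addv.2 he₁ hX₂.typeGOrd hX₂.addv.2 he₂ hv
      exact ⟨L₁, L₂, hL₁, hL₂, hX₁.gr_invariants_eq_zero_of_isRamifiedOrdinaryLine κ he₁ hv hL₁,
        hX₂.gr_invariants_eq_zero_of_isRamifiedOrdinaryLine κ he₂ hv hL₂, hm⟩)
    (not_dvd_torsionOrder_of_irr' p W₁ hX₁.1.2.2) hS₁ hS₂ hT

/-- **GV's transfer count at EVERY odd additive prime `p`, X3♯(G-ord, `e = 2`) pairs (REDUCIBLE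
`E_i[p]`), every local hypothesis discharged**, with `p ∤ #E₁(ℚ)_tors` explicit (the X3 rows' census
bit — the partner's follows from `TorsionIso`; no image hypothesis anywhere). X3♯ stays as labelled; nothing booked.
[cite: GreenbergVatsal2000, §2 Prop. (2.8), Remark (2.9) and pp. 26–27] -/
theorem ClassX3Gord.exists_data_natCard_gvSelmerInfty_inf_torsion_eq (hp2 : p ≠ 2)
    (hX₁ : ClassX3Gord W₁ p) (he₁ : semistabilityIndex W₁ p = 2)
    (hX₂ : ClassX3Gord W₂ p) (he₂ : semistabilityIndex W₂ p = 2)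
    (htors₁ : ¬ p ∣ W₁.torsionOrder)
    (hS₁ : ∀ v : HeightOneSpectrum (𝓞 ℚ), v ∉ S₀ → ((p : ℕ) : 𝓞 ℚ) ∉ v.asIdeal →
      W₁.HasGoodReductionAt v)
    (hS₂ : ∀ v : HeightOneSpectrum (𝓞 ℚ), v ∉ S₀ → ((p : ℕ) : 𝓞 ℚ) ∉ v.asIdeal →
      W₂.HasGoodReductionAt v)
    (hT : TorsionIso W₁ W₂ p) :
    ∃ (L₁ : Data ℚ (W₁.geomPrimaryTorsion p) p) (L₂ : Data ℚ (W₂.geomPrimaryTorsion p) p),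
      (∀ v hv, IsRamifiedOrdinaryLine W₁ p (L₁ v hv)) ∧ (∀ v hv, IsRamifiedOrdinaryLine W₂ p (L₂ v hv)) ∧
      Nat.card (gvSelmerInfty κ (W₁.geomPrimaryTorsion p) L₁ S₀ ⊓
          (subgroupH1 κ.kerSubgroup (W₁.geomPrimaryTorsion p))[(p : ℤ)] :
          AddSubgroup (subgroupH1 κ.kerSubgroup (W₁.geomPrimaryTorsion p))) =
        Nat.card (gvSelmerInfty κ (W₂.geomPrimaryTorsion p) L₂ S₀ ⊓
          (subgroupH1 κ.kerSubgroup (W₂.geomPrimaryTorsion p))[(p : ℤ)] :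
          AddSubgroup (subgroupH1 κ.kerSubgroup (W₂.geomPrimaryTorsion p))) :=
  exists_data_natCard_gvSelmerInfty_inf_torsion_eq_of_forall_lines κ S₀
    (fun v hv ↦ by
      obtain ⟨L₁, L₂, hL₁, hL₂, hm⟩ :=
        AdditivePotMult.GreenbergVatsalTransferCountOdd.exists_lines_matching_of_typeGOrd_typeGOrd
          hp2 hX₁.typeGOrd hX₁.addv he₁ hX₂.typeGOrd hX₂.addv he₂ hv
      exact ⟨L₁, L₂, hL₁, hL₂,
        ClassX3Gord.gr_invariants_eq_zero_of_isRamifiedOrdinaryLine κ hp2 hX₁ he₁ hv hL₁,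
        ClassX3Gord.gr_invariants_eq_zero_of_isRamifiedOrdinaryLine κ hp2 hX₂ he₂ hv hL₂, hm⟩)
    htors₁ hS₁ hS₂ hT

end Gord
end Summit.BirchSwinnertonDyer.Rank1Residual.Additive

/-! ## §3. (M)² — mod A40/A41 -/

namespace Summit.BirchSwinnertonDyer.Rank1Residual.AdditivePotMult

open Summit.BirchSwinnertonDyer.Rank1Residual.Additive
open Summit.BirchSwinnertonDyer.Rank1Residual.X1.CongruenceTransfer (TorsionIso)

section PotMultPairs

variable {p : ℕ} [hp : Fact p.Prime] {W₁ W₂ : WeierstrassCurve ℚ} [W₁.IsElliptic] [W₂.IsElliptic]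
  (κ : ZpExtension ℚ p) (S₀ : Set (HeightOneSpectrum (𝓞 ℚ)))

/-- **GV's transfer count at every odd `p`, pot-mult(p) × pot-mult(p) pairs** (mod the PUBLISHED Tate
uniformisation A40/A41, as everywhere on the (M) rows), with `p ∤ #E₁(ℚ)_tors` explicit: p07's
`PotMult.exists_lines_matching` + FILE 1's `h0` for every line + §1's assembly.
[cite: GreenbergVatsal2000, §2 Prop. (2.8), Remark (2.9) and pp. 26–27] [cite: SilvermanATAEC1994, Ch. V Thm. 5.3, Cor. 5.4] -/
theorem PotMult.exists_data_natCard_gvSelmerInfty_inf_torsion_eq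
    (hT40 : Silverman1994_thmV53_tateUniformisation.{0})
    (hT41 : Silverman1994_thmV53_corV54_tateUniformisation.{0}) (hp2 : p ≠ 2)
    (hpm₁ : PotMult W₁ p) (hpm₂ : PotMult W₂ p)
    (htors₁ : ¬ p ∣ W₁.torsionOrder)
    (hS₁ : ∀ v : HeightOneSpectrum (𝓞 ℚ), v ∉ S₀ → ((p : ℕ) : 𝓞 ℚ) ∉ v.asIdeal →
      W₁.HasGoodReductionAt v)
    (hS₂ : ∀ v : HeightOneSpectrum (𝓞 ℚ), v ∉ S₀ → ((p : ℕ) : 𝓞 ℚ) ∉ v.asIdeal →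
      W₂.HasGoodReductionAt v)
    (hT : TorsionIso W₁ W₂ p) :
    ∃ (L₁ : Data ℚ (W₁.geomPrimaryTorsion p) p) (L₂ : Data ℚ (W₂.geomPrimaryTorsion p) p),
      (∀ v hv, IsRamifiedOrdinaryLine W₁ p (L₁ v hv)) ∧ (∀ v hv, IsRamifiedOrdinaryLine W₂ p (L₂ v hv)) ∧
      Nat.card (gvSelmerInfty κ (W₁.geomPrimaryTorsion p) L₁ S₀ ⊓
          (subgroupH1 κ.kerSubgroup (W₁.geomPrimaryTorsion p))[(p : ℤ)] :
          AddSubgroup (subgroupH1 κ.kerSubgroup (W₁.geomPrimaryTorsion p))) =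
        Nat.card (gvSelmerInfty κ (W₂.geomPrimaryTorsion p) L₂ S₀ ⊓
          (subgroupH1 κ.kerSubgroup (W₂.geomPrimaryTorsion p))[(p : ℤ)] :
          AddSubgroup (subgroupH1 κ.kerSubgroup (W₂.geomPrimaryTorsion p))) :=
  exists_data_natCard_gvSelmerInfty_inf_torsion_eq_of_forall_lines κ S₀
    (fun v hv ↦ by
      obtain ⟨L₁, L₂, hL₁, hL₂, hm⟩ := PotMult.exists_lines_matching hT40 hT41 hpm₁ hpm₂ hp2 hv
      exact ⟨L₁, L₂, hL₁, hL₂,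
        hpm₁.gr_invariants_eq_zero_of_isRamifiedOrdinaryLine κ hT40 hT41 hp2 hv hL₁,
        hpm₂.gr_invariants_eq_zero_of_isRamifiedOrdinaryLine κ hT40 hT41 hp2 hv hL₂, hm⟩)
    htors₁ hS₁ hS₂ hT

/-- **GV's transfer count at every odd `p` (`p = 3` included), X4(M) × X4(M) pairs** (mod A40/A41;
`p ∤ #E₁(ℚ)_tors` from the irreducibility of `E₁[p]`). X4(M) stays CONSTRUCTION-SHAPED; nothing booked.
[cite: GreenbergVatsal2000, §2 Prop. (2.8), Remark (2.9) and pp. 26–27] [cite: SilvermanATAEC1994, Ch. V Thm. 5.3, Cor. 5.4] -/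
theorem ClassX4M.exists_data_natCard_gvSelmerInfty_inf_torsion_eq
    (hT40 : Silverman1994_thmV53_tateUniformisation.{0})
    (hT41 : Silverman1994_thmV53_corV54_tateUniformisation.{0})
    (hX₁ : ClassX4M W₁ p) (hX₂ : ClassX4M W₂ p)
    (hS₁ : ∀ v : HeightOneSpectrum (𝓞 ℚ), v ∉ S₀ → ((p : ℕ) : 𝓞 ℚ) ∉ v.asIdeal →
      W₁.HasGoodReductionAt v)
    (hS₂ : ∀ v : HeightOneSpectrum (𝓞 ℚ), v ∉ S₀ → ((p : ℕ) : 𝓞 ℚ) ∉ v.asIdeal →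
      W₂.HasGoodReductionAt v)
    (hT : TorsionIso W₁ W₂ p) :
    ∃ (L₁ : Data ℚ (W₁.geomPrimaryTorsion p) p) (L₂ : Data ℚ (W₂.geomPrimaryTorsion p) p),
      (∀ v hv, IsRamifiedOrdinaryLine W₁ p (L₁ v hv)) ∧ (∀ v hv, IsRamifiedOrdinaryLine W₂ p (L₂ v hv)) ∧
      Nat.card (gvSelmerInfty κ (W₁.geomPrimaryTorsion p) L₁ S₀ ⊓
          (subgroupH1 κ.kerSubgroup (W₁.geomPrimaryTorsion p))[(p : ℤ)] :
          AddSubgroup (subgroupH1 κ.kerSubgroup (W₁.geomPrimaryTorsion p))) =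
        Nat.card (gvSelmerInfty κ (W₂.geomPrimaryTorsion p) L₂ S₀ ⊓
          (subgroupH1 κ.kerSubgroup (W₂.geomPrimaryTorsion p))[(p : ℤ)] :
          AddSubgroup (subgroupH1 κ.kerSubgroup (W₂.geomPrimaryTorsion p))) :=
  PotMult.exists_data_natCard_gvSelmerInfty_inf_torsion_eq κ S₀ hT40 hT41 hX₁.p_ne_two
    (ClassX4M.potMult W₁ p hX₁) (ClassX4M.potMult W₂ p hX₂)
    (not_dvd_torsionOrder_of_irr' p W₁ hX₁.1.2.2) hS₁ hS₂ hT

/-- **GV's transfer count at every odd `p`, X3♯(M) × X3♯(M) pairs** (REDUCIBLE `E_i[p]`; mod A40/A41;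
`p ∤ #E₁(ℚ)_tors` explicit). X3♯(M) stays as labelled; nothing booked.
[cite: GreenbergVatsal2000, §2 Prop. (2.8), Remark (2.9) and pp. 26–27] [cite: SilvermanATAEC1994, Ch. V Thm. 5.3, Cor. 5.4] -/
theorem ClassX3M.exists_data_natCard_gvSelmerInfty_inf_torsion_eq [W₁.IsGloballyMinimal]
    [W₂.IsGloballyMinimal]
    (hT40 : Silverman1994_thmV53_tateUniformisation.{0})
    (hT41 : Silverman1994_thmV53_corV54_tateUniformisation.{0})
    (hX₁ : ClassX3M W₁ p) (hX₂ : ClassX3M W₂ p)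
    (htors₁ : ¬ p ∣ W₁.torsionOrder)
    (hS₁ : ∀ v : HeightOneSpectrum (𝓞 ℚ), v ∉ S₀ → ((p : ℕ) : 𝓞 ℚ) ∉ v.asIdeal →
      W₁.HasGoodReductionAt v)
    (hS₂ : ∀ v : HeightOneSpectrum (𝓞 ℚ), v ∉ S₀ → ((p : ℕ) : 𝓞 ℚ) ∉ v.asIdeal →
      W₂.HasGoodReductionAt v)
    (hT : TorsionIso W₁ W₂ p) :
    ∃ (L₁ : Data ℚ (W₁.geomPrimaryTorsion p) p) (L₂ : Data ℚ (W₂.geomPrimaryTorsion p) p),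
      (∀ v hv, IsRamifiedOrdinaryLine W₁ p (L₁ v hv)) ∧ (∀ v hv, IsRamifiedOrdinaryLine W₂ p (L₂ v hv)) ∧
      Nat.card (gvSelmerInfty κ (W₁.geomPrimaryTorsion p) L₁ S₀ ⊓
          (subgroupH1 κ.kerSubgroup (W₁.geomPrimaryTorsion p))[(p : ℤ)] :
          AddSubgroup (subgroupH1 κ.kerSubgroup (W₁.geomPrimaryTorsion p))) =
        Nat.card (gvSelmerInfty κ (W₂.geomPrimaryTorsion p) L₂ S₀ ⊓
          (subgroupH1 κ.kerSubgroup (W₂.geomPrimaryTorsion p))[(p : ℤ)] :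
          AddSubgroup (subgroupH1 κ.kerSubgroup (W₂.geomPrimaryTorsion p))) :=
  PotMult.exists_data_natCard_gvSelmerInfty_inf_torsion_eq κ S₀ hT40 hT41 (ClassX3M.p_ne_two W₁ p hX₁)
    (ClassX3M.potMult W₁ p hX₁) (ClassX3M.potMult W₂ p hX₂) htors₁ hS₁ hS₂ hT

end PotMultPairs
/-! ## §4. Mixed pairs: (G-ord, `e = 2`) × pot-mult(p) — mod A40/A41 on the (M) side -/

section Mixed

variable {p : ℕ} [hp : Fact p.Prime] {W₁ W₂ : WeierstrassCurve ℚ} [W₁.IsElliptic]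
  [W₁.IsGloballyMinimal] [W₂.IsElliptic] (κ : ZpExtension ℚ p) (S₀ : Set (HeightOneSpectrum (𝓞 ℚ)))

/-- **GV's transfer count at every odd `p`, MIXED pairs: (G-ord, `e = 2`) × pot-mult(p)** (mod A40/A41
for the (M) side; `p ∤ #E₁(ℚ)_tors` explicit; the (G-ord) side's `h0` for every line supplied as `h0₁`,
discharged on X4♯(G-ord)/X3♯(G-ord) below): p07's `exists_lines_matching_of_typeGOrd_potMult` + FILE 1
+ §1. [cite: GreenbergVatsal2000, §2 Prop. (2.8), Remark (2.9) and pp. 26–27] [cite: SilvermanATAEC1994, Ch. V Thm. 5.3, Cor. 5.4] -/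
theorem exists_data_natCard_gvSelmerInfty_inf_torsion_eq_of_typeGOrd_potMult
    (hT40 : Silverman1994_thmV53_tateUniformisation.{0})
    (hT41 : Silverman1994_thmV53_corV54_tateUniformisation.{0}) (hp2 : p ≠ 2)
    (hG₁ : TypeGOrd W₁ p) (hadd₁ : Addv W₁ p) (he₁ : semistabilityIndex W₁ p = 2)
    (hpm₂ : PotMult W₂ p)
    (h0₁ : ∀ (v : HeightOneSpectrum (𝓞 ℚ)) (hv : ((p : ℕ) : 𝓞 ℚ) ∈ v.asIdeal)
      (L : LocalDatum ℚ (W₁.geomPrimaryTorsion p) v), IsRamifiedOrdinaryLine W₁ p L →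
        ∀ a ∈ invariants (inertiaIn κ.kerSubgroup v) L.Gr, a = 0)
    (htors₁ : ¬ p ∣ W₁.torsionOrder)
    (hS₁ : ∀ v : HeightOneSpectrum (𝓞 ℚ), v ∉ S₀ → ((p : ℕ) : 𝓞 ℚ) ∉ v.asIdeal →
      W₁.HasGoodReductionAt v)
    (hS₂ : ∀ v : HeightOneSpectrum (𝓞 ℚ), v ∉ S₀ → ((p : ℕ) : 𝓞 ℚ) ∉ v.asIdeal →
      W₂.HasGoodReductionAt v)
    (hT : TorsionIso W₁ W₂ p) :
    ∃ (L₁ : Data ℚ (W₁.geomPrimaryTorsion p) p) (L₂ : Data ℚ (W₂.geomPrimaryTorsion p) p),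
      (∀ v hv, IsRamifiedOrdinaryLine W₁ p (L₁ v hv)) ∧ (∀ v hv, IsRamifiedOrdinaryLine W₂ p (L₂ v hv)) ∧
      Nat.card (gvSelmerInfty κ (W₁.geomPrimaryTorsion p) L₁ S₀ ⊓
          (subgroupH1 κ.kerSubgroup (W₁.geomPrimaryTorsion p))[(p : ℤ)] :
          AddSubgroup (subgroupH1 κ.kerSubgroup (W₁.geomPrimaryTorsion p))) =
        Nat.card (gvSelmerInfty κ (W₂.geomPrimaryTorsion p) L₂ S₀ ⊓
          (subgroupH1 κ.kerSubgroup (W₂.geomPrimaryTorsion p))[(p : ℤ)] :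
          AddSubgroup (subgroupH1 κ.kerSubgroup (W₂.geomPrimaryTorsion p))) :=
  exists_data_natCard_gvSelmerInfty_inf_torsion_eq_of_forall_lines κ S₀
    (fun v hv ↦ by
      obtain ⟨L₁, L₂, hL₁, hL₂, hm⟩ :=
        RamifiedOrdinaryLineMatchingMixed.exists_lines_matching_of_typeGOrd_potMult hT40 hT41 hp2 hG₁
          hadd₁ he₁ hpm₂ hv
      exact ⟨L₁, L₂, hL₁, hL₂, h0₁ v hv L₁ hL₁,
        hpm₂.gr_invariants_eq_zero_of_isRamifiedOrdinaryLine κ hT40 hT41 hp2 hv hL₂, hm⟩)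
    htors₁ hS₁ hS₂ hT

/-- **X4♯(G-ord, `e = 2`) × X4(M) at the same odd `p` (`p = 3` included): GV's transfer count**, every
local hypothesis discharged ((M) side mod A40/A41; torsion bits from irreducibility). Nothing booked.
[cite: GreenbergVatsal2000, §2 Prop. (2.8), Remark (2.9) and pp. 26–27] [cite: SilvermanATAEC1994, Ch. V Thm. 5.3, Cor. 5.4] -/
theorem ClassX4M.exists_data_natCard_gvSelmerInfty_inf_torsion_eq_of_classX4Gord
    (hT40 : Silverman1994_thmV53_tateUniformisation.{0})
    (hT41 : Silverman1994_thmV53_corV54_tateUniformisation.{0})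
    (hX₁ : ClassX4Gord W₁ p) (he₁ : semistabilityIndex W₁ p = 2) (hX₂ : ClassX4M W₂ p)
    (hS₁ : ∀ v : HeightOneSpectrum (𝓞 ℚ), v ∉ S₀ → ((p : ℕ) : 𝓞 ℚ) ∉ v.asIdeal →
      W₁.HasGoodReductionAt v)
    (hS₂ : ∀ v : HeightOneSpectrum (𝓞 ℚ), v ∉ S₀ → ((p : ℕ) : 𝓞 ℚ) ∉ v.asIdeal →
      W₂.HasGoodReductionAt v)
    (hT : TorsionIso W₁ W₂ p) :
    ∃ (L₁ : Data ℚ (W₁.geomPrimaryTorsion p) p) (L₂ : Data ℚ (W₂.geomPrimaryTorsion p) p),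
      (∀ v hv, IsRamifiedOrdinaryLine W₁ p (L₁ v hv)) ∧ (∀ v hv, IsRamifiedOrdinaryLine W₂ p (L₂ v hv)) ∧
      Nat.card (gvSelmerInfty κ (W₁.geomPrimaryTorsion p) L₁ S₀ ⊓
          (subgroupH1 κ.kerSubgroup (W₁.geomPrimaryTorsion p))[(p : ℤ)] :
          AddSubgroup (subgroupH1 κ.kerSubgroup (W₁.geomPrimaryTorsion p))) =
        Nat.card (gvSelmerInfty κ (W₂.geomPrimaryTorsion p) L₂ S₀ ⊓
          (subgroupH1 κ.kerSubgroup (W₂.geomPrimaryTorsion p))[(p : ℤ)] :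
          AddSubgroup (subgroupH1 κ.kerSubgroup (W₂.geomPrimaryTorsion p))) :=
  exists_data_natCard_gvSelmerInfty_inf_torsion_eq_of_typeGOrd_potMult κ S₀ hT40 hT41 hX₁.addv.1
    hX₁.typeGOrd hX₁.addv.2 he₁ (ClassX4M.potMult W₂ p hX₂)
    (fun _ hv _ hL ↦ hX₁.gr_invariants_eq_zero_of_isRamifiedOrdinaryLine κ he₁ hv hL)
    (not_dvd_torsionOrder_of_irr' p W₁ hX₁.1.2.2) hS₁ hS₂ hT

/-- **X3♯(G-ord, `e = 2`) × X3♯(M) at the same odd `p`: GV's transfer count** (REDUCIBLE `E_i[p]`;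
(M) side mod A40/A41; `p ∤ #E₁(ℚ)_tors` explicit). Nothing booked.
[cite: GreenbergVatsal2000, §2 Prop. (2.8), Remark (2.9) and pp. 26–27] [cite: SilvermanATAEC1994, Ch. V Thm. 5.3, Cor. 5.4] -/
theorem ClassX3M.exists_data_natCard_gvSelmerInfty_inf_torsion_eq_of_classX3Gord [W₂.IsGloballyMinimal]
    (hT40 : Silverman1994_thmV53_tateUniformisation.{0})
    (hT41 : Silverman1994_thmV53_corV54_tateUniformisation.{0}) (hp2 : p ≠ 2)
    (hX₁ : ClassX3Gord W₁ p) (he₁ : semistabilityIndex W₁ p = 2) (hX₂ : ClassX3M W₂ p)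
    (htors₁ : ¬ p ∣ W₁.torsionOrder)
    (hS₁ : ∀ v : HeightOneSpectrum (𝓞 ℚ), v ∉ S₀ → ((p : ℕ) : 𝓞 ℚ) ∉ v.asIdeal →
      W₁.HasGoodReductionAt v)
    (hS₂ : ∀ v : HeightOneSpectrum (𝓞 ℚ), v ∉ S₀ → ((p : ℕ) : 𝓞 ℚ) ∉ v.asIdeal →
      W₂.HasGoodReductionAt v)
    (hT : TorsionIso W₁ W₂ p) :
    ∃ (L₁ : Data ℚ (W₁.geomPrimaryTorsion p) p) (L₂ : Data ℚ (W₂.geomPrimaryTorsion p) p),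
      (∀ v hv, IsRamifiedOrdinaryLine W₁ p (L₁ v hv)) ∧ (∀ v hv, IsRamifiedOrdinaryLine W₂ p (L₂ v hv)) ∧
      Nat.card (gvSelmerInfty κ (W₁.geomPrimaryTorsion p) L₁ S₀ ⊓
          (subgroupH1 κ.kerSubgroup (W₁.geomPrimaryTorsion p))[(p : ℤ)] :
          AddSubgroup (subgroupH1 κ.kerSubgroup (W₁.geomPrimaryTorsion p))) =
        Nat.card (gvSelmerInfty κ (W₂.geomPrimaryTorsion p) L₂ S₀ ⊓
          (subgroupH1 κ.kerSubgroup (W₂.geomPrimaryTorsion p))[(p : ℤ)] :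
          AddSubgroup (subgroupH1 κ.kerSubgroup (W₂.geomPrimaryTorsion p))) :=
  exists_data_natCard_gvSelmerInfty_inf_torsion_eq_of_typeGOrd_potMult κ S₀ hT40 hT41 hp2
    hX₁.typeGOrd hX₁.addv he₁ (ClassX3M.potMult W₂ p hX₂)
    (fun _ hv _ hL ↦ ClassX3Gord.gr_invariants_eq_zero_of_isRamifiedOrdinaryLine κ hp2 hX₁ he₁ hv hL)
    htors₁ hS₁ hS₂ hT

end Mixed
end Summit.BirchSwinnertonDyer.Rank1Residual.AdditivePotMult
end
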